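import Mathlib
import HarnessLib
import Summits.NavierStokesRegularity.NavierStokesRegularity.Theorems.PoloidalWindowDoorLrcModEntireJetCertRelabelParts

/-!
# Route `PoloidalWindowDoor`, item `LrcModEntire` (stmt-NavierStokesRegularity-20428) — certificate checker: the per-direction relabeling check SPLIT BY LETTER RANGES
# (so that dictionaries beyond the single-file farm budget are certified in as many `native_decide` files as needed)

Cell ns-regularity-ideate, seat ns-k2-port-2 g2 (kernel-port lineage under the LEAD of item 20428; `--supports stmt-NavierStokesRegularity-20428`).  Sequel of
`…JetCertRelabelParts` (K2-p3 g8: `relabelCheck` = four directions + laws + pins).  For the time-jet dictionary `…THCertSliceUD8T` the direction-`z` part alone takes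
281 s on the farm; the next ranges (w ≤ 10, 11 — what a block-11/12 certificate would need, `Cruxes/LrcModEntire/PORT-SIZING-g8.md` §4) exceed any single file.  Here
`relabelCheckDirRange … j lo len` checks the table transfer of direction `j` for the letters `lo ≤ a < lo + len` only, and `relabelCheckDir_of_ranges` reassembles a
direction from a list of ranges covering `0 … m−1` (the cover is a `decide`); with `…RelabelParts.relabelCheck_of_parts` this gives `relabelCheck` from arbitrarily many
small files.  Generic; no Navier–Stokes content.  WHAT THIS IS NOT: not a claim about Navier–Stokes, not a dictionary. [folklore]
-/

noncomputable section

-- the summit and its single sub-problem share the name (CONVENTIONS §1), as in every Theorems file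
set_option linter.dupNamespace false

namespace Summit.NavierStokesRegularity.NavierStokesRegularity.Theorems.PoloidalWindowDoorLrcModEntireJetCertRelabelRanges

open Literature.Analysis.ValidatedNumerics Literature.Analysis.ValidatedNumerics.QMvPoly
open Summit.NavierStokesRegularity.NavierStokesRegularity.Theorems.PoloidalWindowDoorLrcModEntireJetCertDefs
open Summit.NavierStokesRegularity.NavierStokesRegularity.Theorems.PoloidalWindowDoorLrcModEntireJetCertMasked
open Summit.NavierStokesRegularity.NavierStokesRegularity.Theorems.PoloidalWindowDoorLrcModEntireJetCertTree
open Summit.NavierStokesRegularity.NavierStokesRegularity.Theorems.PoloidalWindowDoorLrcModEntireJetCertFast2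
open Summit.NavierStokesRegularity.NavierStokesRegularity.Theorems.PoloidalWindowDoorLrcModEntireJetCertRelabel
open Summit.NavierStokesRegularity.NavierStokesRegularity.Theorems.PoloidalWindowDoorLrcModEntireJetCertRelabelParts

variable {n : ℕ}

/-- The table-transfer check of ONE new letter `a` in direction `j` (the body of `…RelabelParts.relabelCheckDir`). [folklore] -/
def relabelCheckLetter (n : ℕ) (S : ℕ → ℕ → QMvPoly) (M : ℕ → ℕ → Bool) (hyps : List QMvPoly) (R : RelabelData) (j a : ℕ) : Bool :=
  !(R.Mf j a) ||
    (usesOnlyTabled n (M j) (R.Tf a) &&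
      (let c := (R.tab.getD j []).getD a ([], 0)
       certCheckS n S M hyps c.1 c.2 (subQ (tderiv n (S j) (R.Tf a)) (compQ R.m R.Tf (R.Sf j a)))))

/-- Table-transfer check for direction `j`, letters `lo ≤ a < lo + len` only. [folklore] -/
def relabelCheckDirRange (n : ℕ) (S : ℕ → ℕ → QMvPoly) (M : ℕ → ℕ → Bool) (hyps : List QMvPoly) (R : RelabelData) (j lo len : ℕ) : Bool :=
  (List.range' lo len).all fun a => relabelCheckLetter n S M hyps R j a

/-- `relabelCheckDir` is the letter-wise check over `0 … m−1`. [folklore] -/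
theorem relabelCheckDir_eq (S : ℕ → ℕ → QMvPoly) (M : ℕ → ℕ → Bool) (hyps : List QMvPoly) (R : RelabelData) (j : ℕ) :
    relabelCheckDir n S M hyps R j = (List.range R.m).all fun a => relabelCheckLetter n S M hyps R j a := rfl

/-- «The ranges `L = [(lo, len), …]` cover `0 … m−1`» (decidable). [folklore] -/
def rangesCover (m : ℕ) (L : List (ℕ × ℕ)) : Bool :=
  (List.range m).all fun a => L.any fun p => decide (p.1 ≤ a) && decide (a < p.1 + p.2)

/-- **REASSEMBLY OF ONE DIRECTION FROM LETTER RANGES**: if the ranges cover `0 … m−1` and each range check holds, the direction check holds. [folklore] -/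
theorem relabelCheckDir_of_ranges {S : ℕ → ℕ → QMvPoly} {M : ℕ → ℕ → Bool} {hyps : List QMvPoly} (R : RelabelData) (j : ℕ)
    (L : List (ℕ × ℕ)) (hcover : rangesCover R.m L = true)
    (hall : ∀ p ∈ L, relabelCheckDirRange n S M hyps R j p.1 p.2 = true) :
    relabelCheckDir n S M hyps R j = true := by
  rw [relabelCheckDir_eq, List.all_eq_true]
  intro a ha
  have hc := List.all_eq_true.1 hcover a ha
  obtain ⟨p, hp, hin⟩ := List.any_eq_true.1 hc
  simp only [Bool.and_eq_true, decide_eq_true_eq] at hin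
  have h := List.all_eq_true.1 (hall p hp) a (by
    rw [List.mem_range'_1]
    exact ⟨hin.1, hin.2⟩)
  exact h

/-- The list form of `hall`: `(L.all fun p => relabelCheckDirRange … p.1 p.2) = true` — convenient when every range theorem is in scope. [folklore] -/
theorem relabelCheckDir_of_rangeList {S : ℕ → ℕ → QMvPoly} {M : ℕ → ℕ → Bool} {hyps : List QMvPoly} (R : RelabelData) (j : ℕ)
    (L : List (ℕ × ℕ)) (hcover : rangesCover R.m L = true)
    (hall : ∀ p ∈ L, relabelCheckDirRange n S M hyps R j p.1 p.2 = true) :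
    relabelCheckDir n S M hyps R j = true :=
  relabelCheckDir_of_ranges R j L hcover hall

/-- Two ranges: the common case `[0, k)` and `[k, m)`. [folklore] -/
theorem relabelCheckDir_of_two {S : ℕ → ℕ → QMvPoly} {M : ℕ → ℕ → Bool} {hyps : List QMvPoly} (R : RelabelData) (j k : ℕ) (hk : k ≤ R.m)
    (h1 : relabelCheckDirRange n S M hyps R j 0 k = true) (h2 : relabelCheckDirRange n S M hyps R j k (R.m - k) = true) :
    relabelCheckDir n S M hyps R j = true := by
  refine relabelCheckDir_of_ranges R j [(0, k), (k, R.m - k)] ?_ ?_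
  · rw [rangesCover, List.all_eq_true]
    intro a ha
    rw [List.mem_range] at ha
    rw [List.any_eq_true]
    by_cases hak : a < k
    · exact ⟨(0, k), by simp, by simp [hak]⟩
    · refine ⟨(k, R.m - k), by simp, ?_⟩
      simp only [Bool.and_eq_true, decide_eq_true_eq]
      omega
  · intro p hp
    simp only [List.mem_cons, List.mem_nil_iff, or_false] at hp
    rcases hp with rfl | rfl
    · exact h1
    · exact h2

/-! ### Self-test: the ranges machinery on the micro-example of `…JetCertRelabel` is exercised by `decide` on a 2-letter identity relabeling. -/

/-- `rangesCover 5 [(0,2),(2,3)] = true` and a non-cover is detected. [folklore] -/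
theorem rangesCover_selfTest : rangesCover 5 [(0, 2), (2, 3)] = true ∧ rangesCover 5 [(0, 2), (3, 2)] = false := by
  decide

end Summit.NavierStokesRegularity.NavierStokesRegularity.Theorems.PoloidalWindowDoorLrcModEntireJetCertRelabelRanges

end
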